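import Literature.AlgebraicGeometry.Surfaces.K3RealMultiplicationCycleInduced
import Literature.AlgebraicGeometry.Surfaces.K3Marking
import HarnessLib

/-!
# The maximal ζ₁₁ real-multiplication family of K3 surfaces: the cycle on an open period set
# (van Geemen–Schütt 2025, Thm. 1.1 (11) / §4.8 / §5.8, with Oguiso–Zhang 2011, Thm. 1.5)

Family `hodge`, layer `Literature/AlgebraicGeometry/Surfaces`. Companion of
`K3RealMultiplicationCycleInduced` (which types the EXISTENCE of one very general member of each
van Geemen–Schütt family): here the ζ₁₁ family of Thm. 1.1 (11) is typed as what it delivers to a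
consumer that descends along rational Hodge isometries — an algebraic cycle inducing the model
real-multiplication endomorphism at every period point of an OPEN subset of the Hodge locus of that
model (the «∃-form open-set input» of the route `HodgeConjecture/MarkmanPartnerTransport`, crux
`PicardThreeK3Squares`, theorem `RMTypeOrbit.hodgeConjectureFor_square_of_exists_on_open_at`).

## Sources (held texts `paper:arxiv-2310.05196` = [GeemenSchutt2023], Forum Math. Sigma 13 (2025) e2,
## and `paper:doi-10-4310-pamq-2011-v7-n4-a26` = [OguisoZhang2011K3Order11]; read 2026-08-28)

* [OguisoZhang2011K3Order11] Thm. 1.5 (p. 1660) with Examples 1.1–1.2 and Prop. 2.3 (p. 1664): for a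
  complex projective K3 surface `X` and an automorphism `g` of order `11` with `g^*ω_X = ζ₁₁ ω_X`
  ("any automorphism of order 11 of a K3 surface is necessarily non-symplectic"), if the invariant
  lattice `M = H²(X, ℤ)^g` is `≅ U`, then "(X, G) is isomorphic to either `(S₆₆, ⟨σ₆₆⟩)`,
  `(X₀, ⟨σ₄₄⟩)`, or `(X_s, ⟨σ⟩)` (`s ≠ 0`)", i.e. `X` is the elliptic K3 surface
  `y² = x³ + bx + (t¹¹ + c)` (`S₆₆ : y² = x³ + (t¹¹ - 1)`, `X_s : y² = x³ + x + (t¹¹ - s)`) and `g`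
  acts by `t ↦ ζ₁₁^{±1} t` (Remark 1.3 (1): the `g`-stable jacobian fibration with base coordinate
  `t`; Remark 1.7 (3): "for generic `(X, G)`, … `T_X` is of rank `20` and isomorphic to …
  `U² ⊕ E₈²` …; the eigenspace with respect to the eigenvalue `ζ₁₁` of the action `g` on `T_X ⊗ ℂ` in
  which the period `ℂω_X` should lie is two dimensional").
* [GeemenSchutt2023] Thm. 1.1: "(11) The 2-dimensional family of elliptic K3 surfaces in §5.8 has
  `ρ = 2` and RM by the degree five field `ℚ(ζ₁₁ + ζ₁₁⁻¹)`." §5.8 (proof): "We consider the family of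
  elliptic K3 surfaces given by the Weierstrass form `y² = x³ + bx + (c₁t¹¹ + c₀)` … the general `X` has
  Picard number two and thus `Pic(X) = U` and `T_X = U² ⊕ E₈²` … We deform … by replacing `t¹¹` by
  `p_{11,a}` … to obtain a 2-dimensional family of K3 surfaces with RM by `F = ℚ(ζ₁₁ + ζ₁₁⁻¹)` as before;
  note that this is a maximal family, since `l = dim_F T_{X,ℚ} = 4` and thus there are `l - 2 = 2`
  moduli" (§2.6/§3.3: the K3 surfaces with the given `F`-action on `T_{X,ℚ}` are parametrized by the
  period lines in the eigenspace `T_ε ⊗ ℂ`, an `(l-2)`-dimensional space). Prop. 4.6/4.7 (the Dickson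
  deformation `𝓔_a : Y² = X³ + α(p_{n,a}(x))X + β(p_{n,a}(x))` of a K3 surface `𝓔` with the order-`n`
  automorphism `σ₀(X,Y,x) = (X,Y,ζ_n x)`; `D_n = ⟨σ, τ⟩` acts on the pull-back `𝓔̃_a`, `𝓔̃_a/τ` is
  birational to `𝓔_a`, and `σ^* + (σ⁻¹)^*` acts on `T_a ≅ T_{𝓔_a,ℚ}`), and **§4.8 "Cycles inducing the
  real multiplication"**: "`[Γ_k]_2 = (σ^{-k})^*` … the action of `ζ_n + ζ_n⁻¹` on `H²(𝓔̃_a, ℚ)` is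
  induced by the cycle `Γ₁ + Γ₋₁` on `𝓔̃_a × 𝓔̃_a`. This cycle induces one on `𝓔_a × 𝓔_a` which defines
  the real multiplication on `T_{X,ℚ}`."

## Lean rendering (D-0014 named fact; ∀ over the lattice datum, ∃ over the open set and the cycles)

The tree has no Weierstrass models, so neither the members nor the automorphism `σ₀` can be named.
What CAN be carried is the statement on the period side, for the model lattice
`Λ = (K3Index → ℤ, k3Gram)` of the tree. The datum of the family is an integral isometry `g` of `Λ`
of order `11` whose invariant lattice `Λ^g` is a hyperbolic plane `⟨u₁, u₂⟩ ≅ U` and whose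
`ζ₁₁ = e^{2πi/11}`-eigenspace carries a period point (`(y₀.y₀) = 0`, `(ȳ₀.y₀) > 0`): by the
surjectivity of the period map and the global Torelli theorem (Huybrechts, Ch. 6 Thm. 3.1, Ch. 7
Thm. 5.3 and Ch. 15 Cor. 2.3: a Hodge isometry acting trivially on `NS ≅ U`, hence fixing an ample
class, is `f^*` for a unique automorphism `f`) such `g` is `η₀ ∘ g₀^* ∘ η₀⁻¹` for a marked projective
K3 surface `(S₀, η₀)` with `NS(S₀) ≅ U` (period generic on the `ζ₁₁`-eigenline family) and an
automorphism `g₀` of order `11`, `g₀^*ω = ζ₁₁ω`, `H²(S₀,ℤ)^{g₀} ≅ U`; by [OguisoZhang2011K3Order11]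
Thm. 1.5 (3) `(S₀, g₀)` is a member `y² = x³ + bx + (t¹¹ + c)` of the family of §5.8 with `g₀ = σ₀`,
`ζ_n = ζ₁₁`. The model
real-multiplication endomorphism is `θ = (g + g⁻¹) ∘ (1 - π_U) ∈ M₂₂(ℚ)` (`π_U` the orthogonal
projector onto `⟨u₁,u₂⟩_ℚ`; `θ = 0` on `U`, `= g + g⁻¹` on `U^⊥ = T`), with `(2,0)`-eigenvalue
`e₀ = ζ₁₁ + ζ₁₁⁻¹ = 2cos(2π/11)`; it is characterised below by its complexification (hypothesis `hθ`).
Along the Dickson deformation (parameters `(a, b, c₁, c₀)` near `a = 0`, markings transported from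
`η₀`) the class `t = ½[(q × q)_*(Γ_σ + Γ_{σ⁻¹})]_*` (§4.8; `q : 𝓔̃_a ⇢ 𝓔_a` the quotient by `τ`,
`q^* ∘ t = (σ^* + (σ⁻¹)^*) ∘ q^*`) is a flat, cup-self-adjoint Hodge endomorphism, hence constant in the
marking; at `a = 0` it is a self-adjoint element of `End_Hdg(T_{S₀,ℚ}) = ℚ(ζ₁₁) = ℚ[g₀^*|_T]` with the
same `(2,0)`-eigenvalue `ζ₁₁ + ζ₁₁⁻¹` as `g₀^* + (g₀^*)⁻¹` (on `𝓔̃_a`: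
`(σ^* + (σ⁻¹)^*)(1 - a/v²)dv = (ζ_n + ζ_n⁻¹)(1 - a/v²)dv`), so `t ∘ (1 - π_U) = η⁻¹ θ_ℂ η` on EVERY
member, and `t ∘ (1 - π_U)` is induced by the algebraic class
`½(q × q)_*(Γ_σ + Γ_{σ⁻¹}) ∘ (Δ - Σᵢ Dᵢ × Dᵢ^∨)` (`D₁, D₂` a basis of `U = ⟨fibre, zero section⟩ ⊂ NS`; composition of correspondences, Fulton
Prop. 16.1.1; the normal form `c · [γ₀]_* ∘ π_T` of `K3RealMultiplicationCycleInduced`). "Maximal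
family" = `l - 2 = 2` effective moduli = the local period map of the marked family into the
`2`-dimensional Hodge locus `{[y] : θ_ℂ y = e₀ y, (y.y) = 0, (ȳ.y) > 0}` has an OPEN image `Ω`; the open
set of the statement is any open `U ⊂ Λ_ℂ` with `U ∩ D_{θ,e₀} = ℂ^× · Ω`, and at each of its period
points the marked member with that period line carries the cycle. The statement quantifies the cycle
clause only over `θ`-GENERIC period points (every rational vector orthogonal to `y` is killed by `θ`,
i.e. `NS = U` in the marking) — weaker than what the argument gives — because that is the consumer's
binder (`CycleEx[θ, e₀, U]` of `…RMTypeOpenExists`, VERBATIM with `thetaC θ` unfolded to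
`Matrix.toLin' (θ.map (algebraMap ℚ ℂ))`, and the route's `MarkedK3` binder expanded verbatim).

Deliberately NOT here: an explicit matrix for `g` (the paper prints `T = U² ⊕ E₈²` and the origin of the
action, not a matrix; identifying a hand-made order-`11` isometry with `σ₀^*` would need a class-number
statement for hermitian lattices over `ℤ[ζ₁₁]` that is not in the sources — the `∀ g` form needs none);
the other invariant lattices `U(11)`, `U ⊕ A₁₀` of [OguisoZhang2011K3Order11] Thm. 1.5 (2); the families
(5), (7), (9) of Thm. 1.1. TODO(general form): once elliptic K3 surfaces with Weierstrass models are in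
the tree, state Prop. 4.6 + §4.8 for every member `𝓔_a` and derive this fact from it.

## References

* [GeemenSchutt2023] B. van Geemen, M. Schütt, On families of K3 surfaces with real multiplication,
  Forum Math. Sigma 13 (2025) e2, arXiv:2310.05196: Thm. 1.1 (11), §2.4–2.6, §3.3–3.4, Lemma 4.3,
  Prop. 4.6–4.7, §4.8, Rem. 4.9, §5.7–5.8.
* [OguisoZhang2011K3Order11] K. Oguiso, D.-Q. Zhang, K3 surfaces with order 11 automorphisms, Pure
  Appl. Math. Q. 7 (2011) 1657–1673 (arXiv:math/9907020): Examples 1.1–1.2, Remark 1.3, Thm. 1.5,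
  Remark 1.7 (3), Prop. 2.3.
* [Huybrechts2016K3] D. Huybrechts, Lectures on K3 Surfaces, CUP 2016: Ch. 1 Prop. 3.5, Ch. 6 Prop. 1.2
  and Thm. 3.1, Ch. 7 Thm. 5.3, Ch. 15 Cor. 2.3.
* [Fulton1998] W. Fulton, Intersection Theory, 2nd ed., §16.1 Prop. 16.1.1.
-/

noncomputable section

open CategoryTheory MonoidalCategory Polynomial
open Literature.AlgebraicTopology.SingularHomology
open Literature.AlgebraicGeometry.HodgeTheory

namespace Literature.AlgebraicGeometry.Surfaces

/-- **van Geemen–Schütt, Thm. 1.1 (11) with Prop. 4.6, §4.8 and §5.8 (the maximal `ζ₁₁`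
real-multiplication family), located on the period domain by Oguiso–Zhang, Thm. 1.5 (3): the model
endomorphism `ζ₁₁ + ζ₁₁⁻¹` is induced by an algebraic cycle at every period point of an open subset of
its Hodge locus.** For every integral isometry `g` of the K3 lattice `Λ = (ℤ^{22}, k3Gram)` (here: a
`ℂ`-linear `k3Form`-isometry of `Λ_ℂ` mapping `ℤ^{22}` into itself) with `g¹¹ = 1`, whose invariant
lattice is a hyperbolic plane `Λ^g = ℤu₁ ⊕ ℤu₂ ≅ U` (`u₁² = u₂² = 0`, `u₁.u₂ = 1`), and whose
`ζ₁₁ = e^{2πi/11}`-eigenspace contains a period point `y₀` (`(y₀.y₀) = 0`, `(ȳ₀.y₀) > 0`) — by period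
surjectivity and global Torelli the cohomological action of an order-`11` automorphism `g₀` of a
projective K3 surface `S₀` with `H²(S₀,ℤ)^{g₀} ≅ U`, hence ([OguisoZhang2011K3Order11] Thm. 1.5 (3),
Prop. 2.3) a member `y² = x³ + bx + (t¹¹ + c)`, `g₀ : t ↦ ζ₁₁t`, of the family of
[GeemenSchutt2023] §5.8 — and for the rational matrix `θ` with `θ_ℂ = (g + g¹⁰) - 2π_U`
(`π_U y = (y.u₂)u₁ + (y.u₁)u₂`; the model of `σ₀^* + (σ₀^*)⁻¹` on `T = U^⊥ ≅ U² ⊕ E₈²`, extended by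
`0` on `U`), there is an open `U ⊂ Λ_ℂ` meeting the Hodge locus
`D_{θ,e₀} = {y : θ_ℂ y = e₀ y, (y.y) = 0, (ȳ.y) > 0}`, `e₀ = 2cos(2π/11) = ζ₁₁ + ζ₁₁⁻¹`, such that every
`θ`-generic period point `y ∈ U ∩ D_{θ,e₀}` (every rational vector orthogonal to `y` is killed by `θ`)
is the period of a marked projective K3 surface `(S', η', p')` (the route's `MarkedK3` clauses: `p'`
an integral generator of `H⁴`, `η'` identifies integral classes with `ℤ^{22}` and the cup product with
`k3Form`, `η'⁻¹y` spans `H^{2,0}`, `y` a projective period point) carrying an algebraic class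
`γ' ∈ algebraicClasses (S' ⊗ S') 2` whose correspondence `[γ']_* = fst_* (snd^*(–) ∪ γ')` (complex
orientations) is EXACTLY `η'⁻¹ ∘ θ_ℂ ∘ η'` — the member of the Dickson deformation
`y² = x³ + bx + c₁p_{11,a}(t) + c₀` with that period (Thm. 1.1 (11): `2 = l - 2` moduli, a maximal
family, so the marked period image is open in the `2`-dimensional Hodge locus) and its cycle
`½(q × q)_*(Γ_σ + Γ_{σ⁻¹}) ∘ π_{U^⊥}` (§4.8: "the action of `ζ_n + ζ_n⁻¹` … is induced by the cycle
`Γ₁ + Γ₋₁` … This cycle induces one on `𝓔_a × 𝓔_a` which defines the real multiplication on `T_{X,ℚ}`";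
flat in the transported marking and equal to `θ` there, see the module docstring). VERBATIM the input
`CycleEx[θ, e₀, U]` ∧ `∃ y₁ ∈ U ∩ D_{θ,e₀}` of the consumer (T‴)
`…Theorems.MarkmanPartnerTransport.RMTypeOrbit.…_square_of_exists_on_open_at` of the Hodge summit.
[cite: GeemenSchutt2023, Thm. 1.1 (11), Prop. 4.6, §4.8, §5.8, §2.6]
[cite: OguisoZhang2011K3Order11, Thm. 1.5 (1) and (3), Prop. 2.3, Remark 1.7 (3)]
[cite: Huybrechts2016K3, Ch. 6 Thm. 3.1, Ch. 7 Thm. 5.3, Ch. 15 Cor. 2.3]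
[cite: Fulton1998, §16.1 Prop. 16.1.1] -/
def VanGeemenSchuett2025_OguisoZhang2011_zeta11_cycleOnOpenPeriodSet : Prop :=
  ∀ (g : Module.End ℂ (K3Index → ℂ)) (u₁ u₂ : K3Index → ℤ) (y₀ : K3Index → ℂ)
    (θ : Matrix K3Index K3Index ℚ),
    -- `g` is an integral isometry of `Λ` of order `11`
    (∀ a b : K3Index → ℂ, k3Form (g a) (g b) = k3Form a b) →
    (∀ v : K3Index → ℤ, ∃ w : K3Index → ℤ, g (fun i => (v i : ℂ)) = fun i => (w i : ℂ)) →
    g ^ 11 = 1 →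
    -- the invariant lattice `Λ^g` is the hyperbolic plane `ℤu₁ ⊕ ℤu₂ ≅ U`
    g (fun i => (u₁ i : ℂ)) = (fun i => (u₁ i : ℂ)) → g (fun i => (u₂ i : ℂ)) = (fun i => (u₂ i : ℂ)) →
    k3Form (fun i => (u₁ i : ℂ)) (fun i => (u₁ i : ℂ)) = 0 →
    k3Form (fun i => (u₂ i : ℂ)) (fun i => (u₂ i : ℂ)) = 0 →
    k3Form (fun i => (u₁ i : ℂ)) (fun i => (u₂ i : ℂ)) = 1 →
    (∀ v : K3Index → ℤ, g (fun i => (v i : ℂ)) = (fun i => (v i : ℂ)) →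
      ∃ m n : ℤ, v = m • u₁ + n • u₂) →
    -- the `ζ₁₁`-eigenspace of `g` carries a period point
    k3Form y₀ y₀ = 0 → 0 < (k3Form (star y₀) y₀).re →
    g y₀ = Complex.exp (2 * Real.pi * Complex.I / 11) • y₀ →
    -- `θ_ℂ = (g + g⁻¹) ∘ (1 - π_U)`, i.e. `θ = 0` on `U` and `= g + g⁻¹` on `U^⊥`
    (∀ y : K3Index → ℂ, Matrix.toLin' (θ.map (algebraMap ℚ ℂ)) y =
      g y + (g ^ 10) y - (2 * k3Form y (fun i => (u₂ i : ℂ))) • (fun i => (u₁ i : ℂ))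
        - (2 * k3Form y (fun i => (u₁ i : ℂ))) • (fun i => (u₂ i : ℂ))) →
    ∃ U : Set (K3Index → ℂ), IsOpen U ∧
      (∃ y₁ ∈ U, Matrix.toLin' (θ.map (algebraMap ℚ ℂ)) y₁ =
          ((2 * Real.cos (2 * Real.pi / 11) : ℝ) : ℂ) • y₁ ∧
        k3Form y₁ y₁ = 0 ∧ 0 < (k3Form (star y₁) y₁).re) ∧
      ∀ y : K3Index → ℂ, y ∈ U →
        Matrix.toLin' (θ.map (algebraMap ℚ ℂ)) y = ((2 * Real.cos (2 * Real.pi / 11) : ℝ) : ℂ) • y →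
        k3Form y y = 0 → 0 < (k3Form (star y) y).re →
        (∀ v : K3Index → ℚ, k3Form (fun i => (v i : ℂ)) y = 0 → Matrix.mulVec θ v = 0) →
        ∃ (S' : Motives.SchemeOver ℂ) (hS' : IsK3Surface S')
          (η' : complexBetti S' (2 * 1) ≃ₗ[ℂ] (K3Index → ℂ)) (p' : complexBetti S' (2 * 2)),
          (p' ≠ 0 ∧ (IsIntegralClass p' ∧
            (∀ q : complexBetti S' (2 * 2), IsIntegralClass q → ∃ n : ℤ, q = n • p') ∧
            (∀ c : complexBetti S' (2 * 1),
              IsIntegralClass c ↔ ∃ v : K3Index → ℤ, η' c = fun i => (v i : ℂ)) ∧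
            (∀ a b : complexBetti S' (2 * 1),
              cupProduct (rfl : 2 * 1 + 2 * 1 = 2 * 2) a b = k3Form (η' a) (η' b) • p') ∧
            IsOfHodgeType 2 S' (2 * 1) 2 0 (LinearEquiv.symm η' y) ∧
            (∀ τ : complexBetti S' (2 * 1), IsOfHodgeType 2 S' (2 * 1) 2 0 τ →
              ∃ t : ℂ, τ = t • LinearEquiv.symm η' y)) ∧
            (k3Form y y = 0 ∧ 0 < (k3Form (star y) y).re ∧
              ∃ u : K3Index → ℤ, k3Form (fun i => (u i : ℂ)) y = 0 ∧
                0 < ∑ i, ∑ j, u i * k3Gram i j * u j)) ∧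
          ∃ γ' ∈ algebraicClasses (S' ⊗ S') 2, ∀ z : complexBetti S' (2 * 1),
            (η'.symm.toLinearMap ∘ₗ (Matrix.toLin' (θ.map (algebraMap ℚ ℂ)) ∘ₗ η'.toLinearMap)) z =
              complexGysin complexOrientationFamily
                (Motives.IsSmoothProjective.tensor_holds hS'.isSmoothProjective hS'.isSmoothProjective)
                hS'.isSmoothProjective (SemiCartesianMonoidalCategory.fst S' S')
                (rfl : 2 * 1 + 2 * 2 + 2 * 2 = 2 * 1 + 2 * (2 + 2))
                (cupProduct (rfl : 2 * 1 + 2 * 2 = 2 * 1 + 2 * 2)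
                  (complexBetti.map (SemiCartesianMonoidalCategory.snd S' S') (2 * 1) z) γ')

/-! ### The ∀-member form (cycle on EVERY member over the open period set) -/

/-- **van Geemen–Schütt, Thm. 1.1 (11) with Prop. 4.6, §4.8 and §5.8 (the maximal `ζ₁₁`
real-multiplication family, Picard number `2` very generally), located on the period domain by Oguiso–Zhang,
Thm. 1.5 (3): the model endomorphism `ζ₁₁ + ζ₁₁⁻¹` is induced by an algebraic cycle on EVERY member over an
open period set — the `θ`-generic members AND the Noether–Lefschetz-special ones.** Same data and same
sources as `VanGeemenSchuett2025_OguisoZhang2011_zeta11_cycleOnOpenPeriodSet` (module docstring of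
`K3RealMultiplicationZeta11OpenFamily`): for every integral isometry `g` of the K3 lattice `Λ = (ℤ²², k3Gram)`
with `g¹¹ = 1`, invariant lattice a hyperbolic plane `Λ^g = ℤu₁ ⊕ ℤu₂ ≅ U`, and a period point `y₀` in its
`ζ₁₁`-eigenspace (by Oguiso–Zhang Thm. 1.5 (3): the action of the order-`11` automorphism `σ₀ : t ↦ ζ₁₁t` of a
member `y² = x³ + bx + (t¹¹ + c)` of the family of §5.8), and the rational `θ` with
`θ_ℂ = (g + g¹⁰) - 2π_U` (the model of `σ₀^* + (σ₀^*)⁻¹` on `T = U^⊥`, `= 0` on `U`), there is an open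
`U ⊂ Λ_ℂ` such that (i) `U` contains a `θ`-GENERIC period point of the Hodge locus
`D_{θ,e₀} = {y : θ_ℂ y = e₀ y, (y.y) = 0, (ȳ.y) > 0}`, `e₀ = 2cos(2π/11)` (the period of a very general
member of the Dickson deformation `y² = x³ + bx + c₁p_{11,a}(t) + c₀`, §5.8: Néron–Severi lattice `U =
ker θ ∩ Λ` very generally), and (ii) EVERY period point `y ∈ U ∩ D_{θ,e₀}` — `θ`-generic or not — is the
period of a marked projective K3 surface `(S', η', p')` (the route's `MarkedK3` clauses) carrying an
algebraic class `γ' ∈ algebraicClasses (S' ⊗ S') 2` whose correspondence `[γ']_* = fst_*(snd^*(–) ∪ γ')`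
(complex orientations) is EXACTLY `η'⁻¹ ∘ θ_ℂ ∘ η'`: the member of the Dickson deformation with that period
(Thm. 1.1 (11): `2 = l - 2` effective moduli, a MAXIMAL family, so the marked period image contains an open
subset of the `2`-dimensional Hodge locus and `U` is taken inside its cone) and its cycle
`½(q × q)_*(Γ_σ + Γ_{σ⁻¹}) ∘ π_{U^⊥}` (§4.8: "the action of `ζ_n + ζ_n⁻¹` … is induced by the cycle
`Γ₁ + Γ₋₁` … This cycle induces one on `𝓔_a × 𝓔_a` which defines the real multiplication on `T_{X,ℚ}`";
algebraic on every member, flat in the transported marking, hence equal to `θ_ℂ` there for EVERY member —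
including the members with larger Néron–Severi lattice, cf. §6.6 for the analogous Noether–Lefschetz sub-loci
of the `√2`-family). The existing fact `VanGeemenSchuett2025_OguisoZhang2011_zeta11_cycleOnOpenPeriodSet`
quantified the cycle clause over `θ`-generic periods only, to match its first consumer (T‴); the present
∀-member form is the binder `OpenAll[θ, e₀]` of the sub-type descent (T⁗)
`…Theorems.MarkmanPartnerTransport.RMTypeOrbit.…_square_of_openAll_of_transc` of the Hodge summit
(Noether–Lefschetz-special surfaces: `ρ(S) = 7`), and it implies the older fact
(drop the genericity clause of the witness, restrict the cycle clause). No uniqueness is asserted.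
TODO(general form): once elliptic K3 surfaces with Weierstrass models are in the tree, state §5.8 + §4.8
for every member `𝓔_a` and derive this fact from it.
[cite: GeemenSchutt2023, Thm. 1.1 (11), Prop. 4.6, §4.8, §5.8, §2.6 and §6.6]
[cite: OguisoZhang2011K3Order11, Thm. 1.5 (1) and (3), Prop. 2.3, Remark 1.7 (3)]
[cite: Huybrechts2016K3, Ch. 6 Thm. 3.1 and Rem. 3.3, Ch. 7 Thm. 5.3, Ch. 15 Cor. 2.3]
[cite: Fulton1998, §16.1 Prop. 16.1.1] -/
def VanGeemenSchuett2025_OguisoZhang2011_zeta11_cycleOnOpenPeriodSet_everyMember : Prop :=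
  ∀ (g : Module.End ℂ (K3Index → ℂ)) (u₁ u₂ : K3Index → ℤ) (y₀ : K3Index → ℂ)
    (θ : Matrix K3Index K3Index ℚ),
    -- `g` is an integral isometry of `Λ` of order `11`
    (∀ a b : K3Index → ℂ, k3Form (g a) (g b) = k3Form a b) →
    (∀ v : K3Index → ℤ, ∃ w : K3Index → ℤ, g (fun i => (v i : ℂ)) = fun i => (w i : ℂ)) →
    g ^ 11 = 1 →
    -- the invariant lattice `Λ^g` is the hyperbolic plane `ℤu₁ ⊕ ℤu₂ ≅ U`
    g (fun i => (u₁ i : ℂ)) = (fun i => (u₁ i : ℂ)) → g (fun i => (u₂ i : ℂ)) = (fun i => (u₂ i : ℂ)) →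
    k3Form (fun i => (u₁ i : ℂ)) (fun i => (u₁ i : ℂ)) = 0 →
    k3Form (fun i => (u₂ i : ℂ)) (fun i => (u₂ i : ℂ)) = 0 →
    k3Form (fun i => (u₁ i : ℂ)) (fun i => (u₂ i : ℂ)) = 1 →
    (∀ v : K3Index → ℤ, g (fun i => (v i : ℂ)) = (fun i => (v i : ℂ)) →
      ∃ m n : ℤ, v = m • u₁ + n • u₂) →
    -- the `ζ₁₁`-eigenspace of `g` carries a period point
    k3Form y₀ y₀ = 0 → 0 < (k3Form (star y₀) y₀).re →
    g y₀ = Complex.exp (2 * Real.pi * Complex.I / 11) • y₀ →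
    -- `θ_ℂ = (g + g⁻¹) ∘ (1 - π_U)`, i.e. `θ = 0` on `U` and `= g + g⁻¹` on `U^⊥`
    (∀ y : K3Index → ℂ, Matrix.toLin' (θ.map (algebraMap ℚ ℂ)) y =
      g y + (g ^ 10) y - (2 * k3Form y (fun i => (u₂ i : ℂ))) • (fun i => (u₁ i : ℂ))
        - (2 * k3Form y (fun i => (u₁ i : ℂ))) • (fun i => (u₂ i : ℂ))) →
    ∃ U : Set (K3Index → ℂ), IsOpen U ∧
      (∃ y₁ ∈ U, Matrix.toLin' (θ.map (algebraMap ℚ ℂ)) y₁ =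
          ((2 * Real.cos (2 * Real.pi / 11) : ℝ) : ℂ) • y₁ ∧
        k3Form y₁ y₁ = 0 ∧ 0 < (k3Form (star y₁) y₁).re ∧
        ∀ v : K3Index → ℚ, k3Form (fun i => (v i : ℂ)) y₁ = 0 → Matrix.mulVec θ v = 0) ∧
      ∀ y : K3Index → ℂ, y ∈ U →
        Matrix.toLin' (θ.map (algebraMap ℚ ℂ)) y = ((2 * Real.cos (2 * Real.pi / 11) : ℝ) : ℂ) • y →
        k3Form y y = 0 → 0 < (k3Form (star y) y).re →
        ∃ (S' : Motives.SchemeOver ℂ) (hS' : IsK3Surface S')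
          (η' : complexBetti S' (2 * 1) ≃ₗ[ℂ] (K3Index → ℂ)) (p' : complexBetti S' (2 * 2)),
          (p' ≠ 0 ∧ (IsIntegralClass p' ∧
            (∀ q : complexBetti S' (2 * 2), IsIntegralClass q → ∃ n : ℤ, q = n • p') ∧
            (∀ c : complexBetti S' (2 * 1),
              IsIntegralClass c ↔ ∃ v : K3Index → ℤ, η' c = fun i => (v i : ℂ)) ∧
            (∀ a b : complexBetti S' (2 * 1),
              cupProduct (rfl : 2 * 1 + 2 * 1 = 2 * 2) a b = k3Form (η' a) (η' b) • p') ∧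
            IsOfHodgeType 2 S' (2 * 1) 2 0 (LinearEquiv.symm η' y) ∧
            (∀ τ : complexBetti S' (2 * 1), IsOfHodgeType 2 S' (2 * 1) 2 0 τ →
              ∃ t : ℂ, τ = t • LinearEquiv.symm η' y)) ∧
            (k3Form y y = 0 ∧ 0 < (k3Form (star y) y).re ∧
              ∃ u : K3Index → ℤ, k3Form (fun i => (u i : ℂ)) y = 0 ∧
                0 < ∑ i, ∑ j, u i * k3Gram i j * u j)) ∧
          ∃ γ' ∈ algebraicClasses (S' ⊗ S') 2, ∀ z : complexBetti S' (2 * 1),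
            (η'.symm.toLinearMap ∘ₗ (Matrix.toLin' (θ.map (algebraMap ℚ ℂ)) ∘ₗ η'.toLinearMap)) z =
              complexGysin complexOrientationFamily
                (Motives.IsSmoothProjective.tensor_holds hS'.isSmoothProjective hS'.isSmoothProjective)
                hS'.isSmoothProjective (SemiCartesianMonoidalCategory.fst S' S')
                (rfl : 2 * 1 + 2 * 2 + 2 * 2 = 2 * 1 + 2 * (2 + 2))
                (cupProduct (rfl : 2 * 1 + 2 * 2 = 2 * 1 + 2 * 2)
                  (complexBetti.map (SemiCartesianMonoidalCategory.snd S' S') (2 * 1) z) γ')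

end Literature.AlgebraicGeometry.Surfaces

end
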